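import Summits.AnomalousDissipation.AnomalousDissipation.Theorems.GalerkinSteadyZerothLaw.Negative.LoadBearing
import Literature.Analysis.FunctionSpaces.TorusEnstrophyOrthogonality
import Literature.Analysis.FunctionSpaces.TorusLerayHelmholtzProofs

/-!
# Negative knowledge for the crux `GalerkinSteadyZerothLaw` (stmt-AnomalousDissipation-2986, route MirrorVariety):
# III, the enstrophy balance and stretching floor (any dimension); the planar transcription of the crux is FALSE

Certified copy of §4 of the cdisprove work file `Cruxes/GalerkinSteadyZerothLaw/Disproof.lean`
(refuter-cdisprove-stmt-AnomalousDissipation-2986-0, cycle 1). Supports stmt-AnomalousDissipation-2986; nothing here asserts a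
Theses decl positively.

On `T²` the enstrophy balance of a steady state has no stretching term (FMRT 2001 App. II.A (A.62), tree
`integral_inner_laplacian_convect_self_eq_zero`): testing the Galerkin equations with `a := ΔU` gives `ν∫|ΔU|² = −∫⟪Δf, U⟫`,
and with `‖∇U‖⁴ ≤ ‖U‖²∫|ΔU|²` the steady Alexakis–Doering bound `(ν‖∇U‖²)² ≤ ν‖Δf‖₂‖U‖₂³` holds at EVERY tested-form steady
Galerkin state of EVERY resolution for EVERY smooth force: `isDivFree_laplacian`, `bandLimited_laplacian`, `gradNormSq_sq_le`,
`enstrophy_balance` (any `d`: `ν∫|ΔU|² = ∫⟪(U·∇)U,ΔU⟫ − ∫⟪Δf,U⟫`), `stretching_floor` (any `d`: loud bounded states have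
enstrophy production `≥ ε²/(νE) − ‖Δf‖₂√E`), `planar_enstrophy_balance`, `planar_loudness_sq_le`, `planar_loudness_sq_le_of_energy_le`,
`not_loudWitness_planar`, and
`not_galerkinSteadyZerothLaw2D : ¬ GalerkinSteadyZerothLaw2D` for the VERBATIM transcription of the crux to `Fin 2`.
Every proof of the crux must use a genuinely three-dimensional mechanism.
-/

noncomputable section

open scoped InnerProductSpace Topology ComplexConjugate
open MeasureTheory Filter UnitAddTorus
open Literature.Analysis.FunctionSpaces Literature.Analysis.FunctionSpaces.Torus
open Literature.Analysis.FluidPDE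

namespace Summit.AnomalousDissipation.AnomalousDissipation.Theorems.GalerkinSteadyZerothLaw.Negative

open Summit.AnomalousDissipation.AnomalousDissipation.Theses.MirrorVariety (GalerkinSteadyZerothLaw)
variable {d : Type*} [Fintype d] [DecidableEq d]

/-! ## §4 Dimension is load-bearing: the two-dimensional transcription of the crux is FALSE

On `T²` the enstrophy balance of a steady state has no stretching term (FMRT 2001 App. II.A (A.62), tree
`integral_inner_laplacian_convect_self_eq_zero`): testing the Galerkin equations with `a := ΔU` (admissible: smooth, div-free,
band-limited) gives `ν∫|ΔU|² = −∫⟪Δf, U⟫ ≤ ‖Δf‖₂‖U‖₂`, and with `‖∇U‖⁴ ≤ ‖U‖²∫|ΔU|²` the steady Alexakis–Doering bound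
`(ν‖∇U‖²)² ≤ ν‖Δf‖₂‖U‖₂³` follows at EVERY tested-form steady Galerkin state of EVERY resolution, for EVERY smooth force.
Hence the verbatim planar crux fails: bounded states are uniformly quiet as `ν_j → 0`. -/

/-- The Laplacian of a smooth divergence-free field on `T^d` is divergence free (Fourier side: `𝓕(ΔU)(k) = −4π²|k|²Û(k)` is
transversal when `Û(k)` is). [folklore] -/
theorem isDivFree_laplacian {U : UnitAddTorus d → EuclideanSpace ℝ d} (hU : IsSmooth U) (hdiv : IsDivFree U) :
    IsDivFree (laplacian U) := by
  refine isDivFree_of_sum_mul_mFourierCoeff_eq_zero hU.laplacian fun k => ?_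
  have h := hdiv.sum_mul_mFourierCoeff_eq_zero hU k
  simp_rw [mFourierCoeff_complexify_laplacian hU k, PiLp.neg_apply, PiLp.smul_apply, smul_eq_mul]
  calc ∑ j, (k j : ℂ) * -((((4 * Real.pi ^ 2 * freqNormSq k : ℝ) : ℂ)) *
          mFourierCoeff (EuclideanSpace.complexify ∘ U) k j)
      = -((((4 * Real.pi ^ 2 * freqNormSq k : ℝ) : ℂ)) *
          ∑ j, (k j : ℂ) * mFourierCoeff (EuclideanSpace.complexify ∘ U) k j) := by
        rw [Finset.mul_sum, ← Finset.sum_neg_distrib]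
        exact Finset.sum_congr rfl fun j _ => by ring
    _ = 0 := by rw [h, mul_zero, neg_zero]

/-- The Laplacian of a band-limited smooth field is band-limited to the same ball. [folklore] -/
theorem bandLimited_laplacian {N : ℕ} {U : UnitAddTorus d → EuclideanSpace ℝ d} (hU : IsSmooth U)
    (hband : BandLimited N U) : BandLimited N (laplacian U) := by
  intro k hk
  rw [mFourierCoeff_complexify_laplacian hU k, hband k hk, smul_zero, neg_zero]

/-- Green: `‖∇U‖² = −∫⟪U, ΔU⟫` for smooth `U`. [folklore] -/
theorem gradNormSq_eq_neg_integral {U : UnitAddTorus d → EuclideanSpace ℝ d} (hU : IsSmooth U) :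
    gradNormSq U = -∫ x, ⟪U x, laplacian U x⟫_ℝ := by
  have hint : ∀ i, Integrable (fun x => ‖partialDeriv i U x‖ ^ 2) volume := fun i =>
    ((hU.partialDeriv i).continuous.norm.pow 2).integrable_unitAddTorus
  rw [integral_inner_laplacian_eq_neg_holds hU, gradNormSq, integral_finsetSum _ fun i _ => hint i, neg_neg]

/-- Interpolation `‖∇U‖⁴ ≤ ‖U‖₂² ∫|ΔU|²` for smooth `U` (Green + Cauchy–Schwarz). [cite: AlexakisDoering2006PLA, §2] -/
theorem gradNormSq_sq_le {U : UnitAddTorus d → EuclideanSpace ℝ d} (hU : IsSmooth U) :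
    gradNormSq U ^ 2 ≤ (∫ x, ‖U x‖ ^ 2) * ∫ x, ‖laplacian U x‖ ^ 2 := by
  have hcs : |∫ x, ⟪U x, laplacian U x⟫_ℝ| ≤
      Real.sqrt (∫ x, ‖U x‖ ^ 2) * Real.sqrt (∫ x, ‖laplacian U x‖ ^ 2) :=
    abs_integral_inner_le_sqrt_mul_sqrt (hU.memLp 2) (hU.laplacian.memLp 2)
  have h0 : 0 ≤ ∫ x, ‖U x‖ ^ 2 := integral_nonneg fun _ => sq_nonneg _
  have h1 : 0 ≤ ∫ x, ‖laplacian U x‖ ^ 2 := integral_nonneg fun _ => sq_nonneg _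
  calc gradNormSq U ^ 2 = |∫ x, ⟪U x, laplacian U x⟫_ℝ| ^ 2 := by rw [gradNormSq_eq_neg_integral hU, ← sq_abs, abs_neg]
    _ ≤ (Real.sqrt (∫ x, ‖U x‖ ^ 2) * Real.sqrt (∫ x, ‖laplacian U x‖ ^ 2)) ^ 2 :=
        pow_le_pow_left₀ (abs_nonneg _) hcs 2
    _ = (∫ x, ‖U x‖ ^ 2) * ∫ x, ‖laplacian U x‖ ^ 2 := by rw [mul_pow, Real.sq_sqrt h0, Real.sq_sqrt h1]

/-- **Enstrophy balance at a tested-form steady Galerkin state (any dimension)**: testing with `a := ΔU` (admissible),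
`ν ∫|ΔU|² = ∫⟪(U·∇)U, ΔU⟫ − ∫⟪Δf, U⟫` — palinstrophy dissipation = enstrophy production by stretching + enstrophy injection
(FMRT 2001 App. II.A (A.55) in tested form). [cite: FoiasManleyRosaTemam2001, App. II.A (A.55)] -/
theorem enstrophy_balance {ν : ℝ} {N : ℕ} {f U : UnitAddTorus d → EuclideanSpace ℝ d}
    (hU : SteadyState ν N f U) (hf : IsSmooth f) :
    ν * ∫ x, ‖laplacian U x‖ ^ 2 = (∫ x, ⟪convect U U x, laplacian U x⟫_ℝ) - ∫ x, ⟪laplacian f x, U x⟫_ℝ := by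
  obtain ⟨hs, hdiv, -, hband, htest⟩ := hU
  have h := htest (laplacian U) hs.laplacian (isDivFree_laplacian hs hdiv) (bandLimited_laplacian hs hband)
  have h1 : ∫ x, ⟪U x, convect U (laplacian U) x⟫_ℝ = -∫ x, ⟪convect U U x, laplacian U x⟫_ℝ := by
    have ha := integral_inner_convect_eq_neg hs hdiv hs hs.laplacian
    linarith
  have h2 : ∫ x, ⟪U x, laplacian (laplacian U) x⟫_ℝ = ∫ x, ‖laplacian U x‖ ^ 2 := by
    calc ∫ x, ⟪U x, laplacian (laplacian U) x⟫_ℝ = ∫ x, ⟪laplacian (laplacian U) x, U x⟫_ℝ :=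
          integral_congr_ae (ae_of_all _ fun x => real_inner_comm _ _)
      _ = ∫ x, ⟪laplacian U x, laplacian U x⟫_ℝ := integral_inner_laplacian_comm hs.laplacian hs
      _ = ∫ x, ‖laplacian U x‖ ^ 2 := integral_congr_ae (ae_of_all _ fun x => real_inner_self_eq_norm_sq _)
  have h3 : ∫ x, ⟪f x, laplacian U x⟫_ℝ = ∫ x, ⟪laplacian f x, U x⟫_ℝ := (integral_inner_laplacian_comm hf hs).symm
  have i1 : Integrable (fun x => ⟪U x, convect U (laplacian U) x⟫_ℝ) volume := (hs.inner (hs.convect hs.laplacian)).integrable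
  have i2 : Integrable (fun x => ν * ⟪U x, laplacian (laplacian U) x⟫_ℝ) volume :=
    (hs.inner hs.laplacian.laplacian).integrable.const_mul ν
  have i3 : Integrable (fun x => ⟪f x, laplacian U x⟫_ℝ) volume := (hf.inner hs.laplacian).integrable
  have i12 : Integrable (fun x => ⟪U x, convect U (laplacian U) x⟫_ℝ + ν * ⟪U x, laplacian (laplacian U) x⟫_ℝ) volume :=
    i1.add i2
  rw [integral_add i12 i3, integral_add i1 i2, integral_const_mul, h1, h2, h3] at h
  linarith

/-- **THE STRETCHING FLOOR (witness anatomy in every dimension).** A loud bounded admissible state of a smooth force at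
`(ν, N)`, `ν ≥ 0`, produces enstrophy at the rate `∫⟪(U·∇)U, ΔU⟫ ≥ ε²/(νE) − ‖Δf‖₂√E`:
`ε² ≤ ν E (∫⟪(U·∇)U, ΔU⟫ + ‖Δf‖₂ √E)` (from `(ν‖∇U‖²)² ≤ ν‖U‖² · ν∫|ΔU|²` and the enstrophy balance). Along a witness sequence
of the crux the enstrophy production by vortex stretching must therefore DIVERGE like `ν_j⁻¹`, uniformly over the resolutions used;
a refutation may assume it, a proof must produce it. In two dimensions the production vanishes identically and the crux fails
(`not_galerkinSteadyZerothLaw2D`). [folklore] -/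
theorem stretching_floor {ν E ε : ℝ} (hν : 0 ≤ ν) {N : ℕ} {f U : UnitAddTorus d → EuclideanSpace ℝ d}
    (hU : SteadyState ν N f U) (hf : IsSmooth f) (hE : ∫ x, ‖U x‖ ^ 2 ≤ E) (hε : 0 ≤ ε)
    (hloud : ε ≤ ν * gradNormSq U) :
    ε ^ 2 ≤ ν * E * ((∫ x, ⟪convect U U x, laplacian U x⟫_ℝ) +
      Real.sqrt (∫ x, ‖laplacian f x‖ ^ 2) * Real.sqrt E) := by
  have hs : IsSmooth U := hU.1
  set P : ℝ := ∫ x, ⟪convect U U x, laplacian U x⟫_ℝ with hP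
  set W : ℝ := ∫ x, ‖U x‖ ^ 2 with hW
  set L : ℝ := ∫ x, ‖laplacian f x‖ ^ 2 with hL
  have hW0 : 0 ≤ W := integral_nonneg fun _ => sq_nonneg _
  have hE0 : 0 ≤ E := hW0.trans hE
  have hbal := enstrophy_balance hU hf
  have hcs : |∫ x, ⟪laplacian f x, U x⟫_ℝ| ≤ Real.sqrt L * Real.sqrt W :=
    abs_integral_inner_le_sqrt_mul_sqrt (hf.laplacian.memLp 2) (hs.memLp 2)
  have hpal0 : 0 ≤ ν * ∫ x, ‖laplacian U x‖ ^ 2 := mul_nonneg hν (integral_nonneg fun _ => sq_nonneg _)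
  -- `ν ∫|ΔU|² = P − ∫⟪Δf,U⟫ ≤ P + √L √W`, and both are `≥ 0`
  have hνL : ν * ∫ x, ‖laplacian U x‖ ^ 2 ≤ P + Real.sqrt L * Real.sqrt W := by
    rw [hbal]
    have := neg_abs_le (∫ x, ⟪laplacian f x, U x⟫_ℝ)
    linarith
  have hPW0 : 0 ≤ P + Real.sqrt L * Real.sqrt W := hpal0.trans hνL
  have hmonoW : P + Real.sqrt L * Real.sqrt W ≤ P + Real.sqrt L * Real.sqrt E := by
    have := mul_le_mul_of_nonneg_left (Real.sqrt_le_sqrt hE) (Real.sqrt_nonneg L)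
    linarith
  have hint := gradNormSq_sq_le hs
  have h1 : ε ^ 2 ≤ (ν * gradNormSq U) ^ 2 := pow_le_pow_left₀ hε hloud 2
  calc ε ^ 2 ≤ (ν * gradNormSq U) ^ 2 := h1
    _ = ν ^ 2 * gradNormSq U ^ 2 := by ring
    _ ≤ ν ^ 2 * (W * ∫ x, ‖laplacian U x‖ ^ 2) := mul_le_mul_of_nonneg_left hint (sq_nonneg ν)
    _ = ν * W * (ν * ∫ x, ‖laplacian U x‖ ^ 2) := by ring
    _ ≤ ν * W * (P + Real.sqrt L * Real.sqrt W) := mul_le_mul_of_nonneg_left hνL (mul_nonneg hν hW0)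
    _ ≤ ν * E * (P + Real.sqrt L * Real.sqrt E) :=
        mul_le_mul (mul_le_mul_of_nonneg_left hE hν) hmonoW hPW0 (mul_nonneg hν hE0)

/-- **Planar enstrophy balance at a tested-form steady Galerkin state**: on `T²`, `ν ∫|ΔU|² = −∫⟪Δf, U⟫` (test with
`a := ΔU`; the trilinear term `∫⟪U,(U·∇)ΔU⟫ = −∫⟪ΔU,(U·∇)U⟫` vanishes in two dimensions). [cite: FoiasManleyRosaTemam2001, App. II.A (A.62)] -/
theorem planar_enstrophy_balance {ν : ℝ} {N : ℕ} {f U : UnitAddTorus (Fin 2) → EuclideanSpace ℝ (Fin 2)}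
    (hU : SteadyState ν N f U) (hf : IsSmooth f) :
    ν * ∫ x, ‖laplacian U x‖ ^ 2 = -∫ x, ⟪laplacian f x, U x⟫_ℝ := by
  obtain ⟨hs, hdiv, -, hband, htest⟩ := hU
  have h := htest (laplacian U) hs.laplacian (isDivFree_laplacian hs hdiv) (bandLimited_laplacian hs hband)
  have h1 : ∫ x, ⟪U x, convect U (laplacian U) x⟫_ℝ = 0 := by
    have ha := integral_inner_convect_eq_neg hs hdiv hs hs.laplacian
    have h2d := integral_inner_laplacian_convect_self_eq_zero hs hdiv
    have hc : ∫ x, ⟪convect U U x, laplacian U x⟫_ℝ = ∫ x, ⟪laplacian U x, convect U U x⟫_ℝ :=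
      integral_congr_ae (ae_of_all _ fun x => real_inner_comm _ _)
    linarith
  have h2 : ∫ x, ⟪U x, laplacian (laplacian U) x⟫_ℝ = ∫ x, ‖laplacian U x‖ ^ 2 := by
    calc ∫ x, ⟪U x, laplacian (laplacian U) x⟫_ℝ = ∫ x, ⟪laplacian (laplacian U) x, U x⟫_ℝ :=
          integral_congr_ae (ae_of_all _ fun x => real_inner_comm _ _)
      _ = ∫ x, ⟪laplacian U x, laplacian U x⟫_ℝ := integral_inner_laplacian_comm hs.laplacian hs
      _ = ∫ x, ‖laplacian U x‖ ^ 2 := integral_congr_ae (ae_of_all _ fun x => real_inner_self_eq_norm_sq _)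
  have h3 : ∫ x, ⟪f x, laplacian U x⟫_ℝ = ∫ x, ⟪laplacian f x, U x⟫_ℝ := (integral_inner_laplacian_comm hf hs).symm
  have i1 : Integrable (fun x => ⟪U x, convect U (laplacian U) x⟫_ℝ) volume := (hs.inner (hs.convect hs.laplacian)).integrable
  have i2 : Integrable (fun x => ν * ⟪U x, laplacian (laplacian U) x⟫_ℝ) volume :=
    (hs.inner hs.laplacian.laplacian).integrable.const_mul ν
  have i3 : Integrable (fun x => ⟪f x, laplacian U x⟫_ℝ) volume := (hf.inner hs.laplacian).integrable
  have i12 : Integrable (fun x => ⟪U x, convect U (laplacian U) x⟫_ℝ + ν * ⟪U x, laplacian (laplacian U) x⟫_ℝ) volume :=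
    i1.add i2
  rw [integral_add i12 i3, integral_add i1 i2, integral_const_mul, h1, h2, h3] at h
  linarith

/-- **The steady Alexakis–Doering bound at the Galerkin level (tested form)**: on `T²`, for `ν ≥ 0`, every admissible
steady Galerkin state of a smooth force obeys `(ν‖∇U‖²)² ≤ ν ‖U‖₂² (‖Δf‖₂ ‖U‖₂)`, uniformly in the resolution.
[cite: AlexakisDoering2006PLA] -/
theorem planar_loudness_sq_le {ν : ℝ} (hν : 0 ≤ ν) {N : ℕ} {f U : UnitAddTorus (Fin 2) → EuclideanSpace ℝ (Fin 2)}
    (hU : SteadyState ν N f U) (hf : IsSmooth f) :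
    (ν * gradNormSq U) ^ 2 ≤
      ν * (∫ x, ‖U x‖ ^ 2) * (Real.sqrt (∫ x, ‖laplacian f x‖ ^ 2) * Real.sqrt (∫ x, ‖U x‖ ^ 2)) := by
  have hs : IsSmooth U := hU.1
  have hZ := planar_enstrophy_balance hU hf
  have hcs : |∫ x, ⟪laplacian f x, U x⟫_ℝ| ≤
      Real.sqrt (∫ x, ‖laplacian f x‖ ^ 2) * Real.sqrt (∫ x, ‖U x‖ ^ 2) :=
    abs_integral_inner_le_sqrt_mul_sqrt (hf.laplacian.memLp 2) (hs.memLp 2)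
  have hνL : ν * ∫ x, ‖laplacian U x‖ ^ 2 ≤ Real.sqrt (∫ x, ‖laplacian f x‖ ^ 2) * Real.sqrt (∫ x, ‖U x‖ ^ 2) := by
    rw [hZ]
    exact (neg_le_abs _).trans hcs
  have hint := gradNormSq_sq_le hs
  have h0 : 0 ≤ ∫ x, ‖U x‖ ^ 2 := integral_nonneg fun _ => sq_nonneg _
  calc (ν * gradNormSq U) ^ 2 = ν ^ 2 * gradNormSq U ^ 2 := by ring
    _ ≤ ν ^ 2 * ((∫ x, ‖U x‖ ^ 2) * ∫ x, ‖laplacian U x‖ ^ 2) := mul_le_mul_of_nonneg_left hint (sq_nonneg ν)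
    _ = ν * (∫ x, ‖U x‖ ^ 2) * (ν * ∫ x, ‖laplacian U x‖ ^ 2) := by ring
    _ ≤ ν * (∫ x, ‖U x‖ ^ 2) * (Real.sqrt (∫ x, ‖laplacian f x‖ ^ 2) * Real.sqrt (∫ x, ‖U x‖ ^ 2)) :=
        mul_le_mul_of_nonneg_left hνL (mul_nonneg hν h0)

/-- **Planar laminarisation of bounded steady Galerkin states, uniformly in `N`**: on `T²`, for a smooth force `f`,
`ν ≥ 0`, energy `≤ E` and any resolution, `(ν‖∇U‖²)² ≤ ν · E · ‖Δf‖₂ · √E`. [cite: AlexakisDoering2006PLA] -/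
theorem planar_loudness_sq_le_of_energy_le {ν E : ℝ} (hν : 0 ≤ ν) {N : ℕ}
    {f U : UnitAddTorus (Fin 2) → EuclideanSpace ℝ (Fin 2)} (hU : SteadyState ν N f U) (hf : IsSmooth f)
    (hE : ∫ x, ‖U x‖ ^ 2 ≤ E) :
    (ν * gradNormSq U) ^ 2 ≤ ν * (E * (Real.sqrt (∫ x, ‖laplacian f x‖ ^ 2) * Real.sqrt E)) := by
  have h0 : 0 ≤ ∫ x, ‖U x‖ ^ 2 := integral_nonneg fun _ => sq_nonneg _
  have hE0 : 0 ≤ E := h0.trans hE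
  have h := planar_loudness_sq_le hν hU hf
  have hmono : (∫ x, ‖U x‖ ^ 2) * (Real.sqrt (∫ x, ‖laplacian f x‖ ^ 2) * Real.sqrt (∫ x, ‖U x‖ ^ 2)) ≤
      E * (Real.sqrt (∫ x, ‖laplacian f x‖ ^ 2) * Real.sqrt E) :=
    mul_le_mul hE (mul_le_mul_of_nonneg_left (Real.sqrt_le_sqrt hE) (Real.sqrt_nonneg _)) (by positivity) hE0
  calc (ν * gradNormSq U) ^ 2
      ≤ ν * (∫ x, ‖U x‖ ^ 2) * (Real.sqrt (∫ x, ‖laplacian f x‖ ^ 2) * Real.sqrt (∫ x, ‖U x‖ ^ 2)) := h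
    _ = ν * ((∫ x, ‖U x‖ ^ 2) * (Real.sqrt (∫ x, ‖laplacian f x‖ ^ 2) * Real.sqrt (∫ x, ‖U x‖ ^ 2))) := by ring
    _ ≤ ν * (E * (Real.sqrt (∫ x, ‖laplacian f x‖ ^ 2) * Real.sqrt E)) := mul_le_mul_of_nonneg_left hmono hν

/-- No force on `T²` has a loud witness (the planar bound sends `ν_j‖∇U‖²` to zero at bounded energy). [folklore] -/
theorem not_loudWitness_planar {f : UnitAddTorus (Fin 2) → EuclideanSpace ℝ (Fin 2)} (hf : IsSmooth f) :
    ¬ LoudWitness f := by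
  rintro ⟨ν, E, ε, hν, hlim, hε, h⟩
  obtain ⟨N₀, U₀, -, hU₀E, -⟩ := (h 0).exists
  have hE0 : 0 ≤ E := (integral_nonneg fun _ => sq_nonneg _).trans hU₀E
  set K : ℝ := E * (Real.sqrt (∫ x, ‖laplacian f x‖ ^ 2) * Real.sqrt E) with hK
  have hK0 : 0 ≤ K := by positivity
  have hev : ∀ᶠ j in atTop, ν j < ε ^ 2 / (K + 1) := hlim.eventually (gt_mem_nhds (by positivity))
  obtain ⟨j, hj⟩ := hev.exists
  obtain ⟨N, U, hU, hUE, hloud⟩ := (h j).exists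
  have h1 : ε ^ 2 ≤ (ν j * gradNormSq U) ^ 2 := pow_le_pow_left₀ hε.le hloud 2
  have h2 : (ν j * gradNormSq U) ^ 2 ≤ ν j * K := planar_loudness_sq_le_of_energy_le (hν j).le hU hf hUE
  have h3 : ν j * (K + 1) < ε ^ 2 := (lt_div_iff₀ (by positivity)).1 hj
  have h4 : ν j * K ≤ ν j * (K + 1) := by nlinarith [hν j]
  linarith

/-- VERBATIM TRANSCRIPTION of the crux to the two-dimensional torus: every `Fin 3` of
`MirrorVariety.GalerkinSteadyZerothLaw` replaced by `Fin 2`, nothing else touched. -/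
def GalerkinSteadyZerothLaw2D : Prop :=
  ∃ f : UnitAddTorus (Fin 2) → EuclideanSpace ℝ (Fin 2), Literature.Analysis.FunctionSpaces.Torus.IsSmooth f ∧ Literature.Analysis.FunctionSpaces.Torus.IsDivFree f ∧ Literature.Analysis.FunctionSpaces.Torus.HasZeroMean f ∧ ∃ (ν : ℕ → ℝ) (E ε : ℝ), (∀ j, 0 < ν j) ∧ Filter.Tendsto ν Filter.atTop (nhds 0) ∧ 0 < ε ∧ ∀ j, ∃ᶠ N in Filter.atTop, ∃ U : UnitAddTorus (Fin 2) → EuclideanSpace ℝ (Fin 2), (Literature.Analysis.FunctionSpaces.Torus.IsSmooth U ∧ Literature.Analysis.FunctionSpaces.Torus.IsDivFree U ∧ Literature.Analysis.FunctionSpaces.Torus.HasZeroMean U ∧ (∀ k ∉ (Literature.Analysis.FunctionSpaces.Torus.freqBall N).erase (0 : Fin 2 → ℤ), UnitAddTorus.mFourierCoeff (Literature.Analysis.FunctionSpaces.EuclideanSpace.complexify ∘ U) k = 0) ∧ ∀ a : UnitAddTorus (Fin 2) → EuclideanSpace ℝ (Fin 2), Literature.Analysis.FunctionSpaces.Torus.IsSmooth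 a → Literature.Analysis.FunctionSpaces.Torus.IsDivFree a → (∀ k ∉ (Literature.Analysis.FunctionSpaces.Torus.freqBall N).erase (0 : Fin 2 → ℤ), UnitAddTorus.mFourierCoeff (Literature.Analysis.FunctionSpaces.EuclideanSpace.complexify ∘ a) k = 0) → ∫ x, (inner ℝ (U x) (Literature.Analysis.FunctionSpaces.Torus.convect U a x) + ν j * inner ℝ (U x) (Literature.Analysis.FunctionSpaces.Torus.laplacian a x) + inner ℝ (f x) (a x)) = 0) ∧ ∫ x, ‖U x‖ ^ 2 ≤ E ∧ ε ≤ ν j * Literature.Analysis.FunctionSpaces.Torus.gradNormSq U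

/-- The planar transcription, unfolded with the generic vocabulary. [folklore] -/
theorem galerkinSteadyZerothLaw2D_iff :
    GalerkinSteadyZerothLaw2D ↔ ∃ f : UnitAddTorus (Fin 2) → EuclideanSpace ℝ (Fin 2),
      IsSmooth f ∧ IsDivFree f ∧ HasZeroMean f ∧ LoudWitness f := Iff.rfl

/-- **DIMENSION IS LOAD-BEARING: the two-dimensional Galerkin steady zeroth law is FALSE.** Every proof of the crux must
use a genuinely three-dimensional mechanism (vortex stretching in the enstrophy balance); every witness force must drive
genuinely three-dimensional states. (The catalogued barrier `AlexakisDoering2006_energyDissipationBound`, certified here for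
the crux's own tested Galerkin form, uniformly in the resolution.) [cite: AlexakisDoering2006PLA] -/
theorem not_galerkinSteadyZerothLaw2D : ¬ GalerkinSteadyZerothLaw2D := by
  rw [galerkinSteadyZerothLaw2D_iff]
  rintro ⟨f, hf, -, -, hW⟩
  exact not_loudWitness_planar hf hW

end Summit.AnomalousDissipation.AnomalousDissipation.Theorems.GalerkinSteadyZerothLaw.Negative

end
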